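import Mathlib
import Summits.NavierStokesRegularity.NavierStokesRegularity.Theorems.TaoLadderRungThreeGappedFrontRobustComparison
import Summits.NavierStokesRegularity.NavierStokesRegularity.Theorems.TaoLadderRungThreeGappedFrontRobustStepTransfer
import HarnessLib

/-!
# `GappedFrontRobust`, the (step) clause: TAMENESS OF A FLOW BEHIND THE FRONT over one clock window
  (a priori amplitude envelope for the exact flow far behind the front, uniform over ball starts;
  helper for item stmt-NavierStokesRegularity-20423 and its announced restatement K_B₂ over `GapData₂`)

HONEST FRAMING: a theorem about Tao-type MODEL lattice pseudo-flows (Tao 2016 §4 Lemma 4.1 (4.5), (4.8)) in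
the cell vocabulary `TaoCascade.PseudoFlowOn`; it is `bootstrap_family` (`…Comparison`) with the constant
profile applied to ONE flow against its start state. Nothing here concerns the Navier–Stokes equations;
nothing is asserted about any table.

WHY. The comparison of the active zone (`…ActiveZone.pseudoFlowOn_active_zone`) needs an amplitude
envelope `A₀` of the EXACT flow on every compared shell. Near the front it is the certificate's epoch
envelope `√(2 env₀)` (finitely many shells); far BEHIND the front the certificate format (`GapData₂`)
does not constrain `env₀`, but the flow cannot move: the rates `(1+ε₀)^{5k/2}` decay faster than the
tame start data `G k ≍ C(1 + (1+ε₀)^{|k|})` (`TameBehind`) grow. `pseudoFlowOn_behind_tameness` makes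
this quantitative: if `|S₀_{i,k}| ≤ G k` for `k ≤ kb`, the boundary shell `kb+1` stays below `3 G(kb+1)`,
and the scalar condition `τ · 2(∑|α|)(1+ε₀)^{5n/2} (3 Ĝ n)² ≤ G n / 2` holds for `n ≤ kb` (`Ĝ n` bounds
`G` on the three shells `n−1, n, n+1`; plus a defect budget `≤ G n / 2` and a uniform Lipschitz bound),
then `|S_{i,n}(t) − S₀_{i,n}| ≤ G n` for all `n ≤ kb`, `t ∈ [0, τ]` — hence `|S_{i,n}(t)| ≤ 2 G n`.
-/

noncomputable section

-- the sub-problem namespace `Summit.NavierStokesRegularity.NavierStokesRegularity` repeats the summit name by design (D-0017)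
set_option linter.dupNamespace false

namespace Summit.NavierStokesRegularity.NavierStokesRegularity.Theorems

open Set MeasureTheory intervalIntegral Literature.Analysis.FluidPDE Literature.Analysis.FluidPDE.TaoCascade

namespace GappedFrontRobust

variable {m : ℕ}
variable {τ ε₀ : ℝ} {α : Fin m → Fin m → Fin m → ℤ × ℤ × ℤ → ℝ} {κ₁ κ₂ : ℝ}
  {S₀ F₀ B₀ : Fin m → ℤ → ℝ} {S F : Fin m → ℤ → ℝ → ℝ}

/-- **TAMENESS BEHIND THE FRONT.** See the module docstring. [cite: Tao2016AveragedNS, §4 Lemma 4.1 (4.5), (4.8); §6.2 Prop. 6.3 (viii) (transition states behind the front)] -/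
theorem pseudoFlowOn_behind_tameness (h : PseudoFlowOn τ ε₀ α κ₁ κ₂ S₀ F₀ B₀ S F) (hτ : 0 < τ)
    (hε : 0 ≤ ε₀) (kb : ℤ) {G Ĝ : ℤ → ℝ} {L : ℝ} (hL : 0 ≤ L) (hG0 : ∀ k, 0 ≤ G k)
    (hstart : ∀ (i : Fin m) (k : ℤ), k ≤ kb → |S₀ i k| ≤ G k)
    (hbdry : ∀ u ∈ Icc 0 τ, ∀ i : Fin m, |S i (kb + 1) u| ≤ 3 * G (kb + 1))
    (hĜ : ∀ n : ℤ, n ≤ kb → ∀ k : ℤ, n - 1 ≤ k → k ≤ n + 1 → G k ≤ Ĝ n)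
    (hcond : ∀ (i : Fin m) (n : ℤ), n ≤ kb →
      τ * (2 * (∑ i₁, ∑ i₂, ∑ μ ∈ shiftSet, |α i₁ i₂ i μ|) * (1 + ε₀) ^ ((5 : ℝ) * n / 2) *
        (3 * Ĝ n) * (3 * Ĝ n)) ≤ G n / 2)
    (hdef : ∀ (i : Fin m) (n : ℤ), n ≤ kb → ∀ t ∈ Icc 0 τ,
      ∫ u in (0 : ℝ)..t, κ₁ * (1 + ε₀) ^ ((2 : ℝ) * n) * Real.sqrt (F i n u) ≤ G n / 2)
    (hlip : ∀ (i : Fin m) (n : ℤ), n ≤ kb → ∀ s ∈ Icc 0 τ, ∀ t ∈ Icc 0 τ,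
      |S i n t - S i n s| ≤ L * G n * |t - s|) :
    ∀ (i : Fin m) (n : ℤ), n ≤ kb → ∀ t ∈ Icc 0 τ, |S i n t - S₀ i n| ≤ G n := by
  have hq : 0 < 1 + ε₀ := by linarith
  -- a uniform a priori bound of the flow (only used off the compared shells)
  obtain ⟨M, hM0, hM⟩ := pseudoFlowOn_uniform_bounds h hq
  -- the family
  set u : Fin m × ℤ → ℝ → ℝ := fun j t => if j.2 ≤ kb then |S j.1 j.2 t - S₀ j.1 j.2| else 0 with hu
  set p : Fin m × ℤ → ℝ := fun j => G j.2 with hp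
  have key := bootstrap_family (ι := Fin m × ℤ) (u := u) (p := p) (ψ := fun _ => (1 : ℝ)) (τ := τ)
    (L := L) (fun j => hG0 j.2) hL continuousOn_const (fun _ _ => one_pos) ?_ ?_ ?_
  · intro i n hn t ht
    have := key (i, n) t ht
    simpa [hu, hp, hn] using this
  · -- uniform Lipschitz
    rintro ⟨i, n⟩ s hs t ht
    by_cases hn : n ≤ kb
    · simp only [hu, hp, hn, if_true]
      refine (abs_abs_sub_abs_le_abs_sub _ _).trans ?_
      have heq : S i n t - S₀ i n - (S i n s - S₀ i n) = S i n t - S i n s := by ring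
      rw [heq]
      exact hlip i n hn s hs t ht
    · simp only [hu, hp, hn, if_false, sub_self, abs_zero]
      exact mul_nonneg (mul_nonneg hL (hG0 n)) (abs_nonneg _)
  · -- start
    rintro ⟨i, n⟩
    by_cases hn : n ≤ kb
    · simp only [hu, hp, hn, if_true, h.init_S, sub_self, abs_zero, one_mul]; exact hG0 n
    · simp only [hu, hp, hn, if_false, one_mul]; exact hG0 n
  · -- improvement
    intro t ht hweak ⟨i, n⟩
    by_cases hn : n ≤ kb
    swap
    · simp only [hu, hp, hn, if_false, one_mul]; exact hG0 n
    simp only [hu, hp, hn, if_true, one_mul]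
    -- amplitude bounds on [0, t]: 3 G on the compared shells and the boundary shell, M elsewhere
    set A : ℤ → ℝ := fun k => if k ≤ kb + 1 then 3 * G k else M with hA
    have hA0 : ∀ k, 0 ≤ A k := fun k => by
      simp only [hA]; split_ifs
      · exact mul_nonneg (by norm_num) (hG0 k)
      · exact hM0
    have hAS : ∀ s ∈ Icc 0 t, ∀ (j : Fin m) (k : ℤ), |S j k s| ≤ A k := by
      intro s hs j k
      have hsτ : s ∈ Icc 0 τ := ⟨hs.1, hs.2.trans ht.2⟩
      simp only [hA]
      split_ifs with hk
      · rcases lt_or_eq_of_le hk with hk' | hk'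
        · have hk'' : k ≤ kb := by linarith
          have hw := hweak (j, k) s hs
          simp only [hu, hp, hk'', if_true] at hw
          have hs0 := hstart j k hk''
          have htri : |S j k s| ≤ |S j k s - S₀ j k| + |S₀ j k| := by
            have := abs_add_le (S j k s - S₀ j k) (S₀ j k); simpa using this
          linarith
        · rw [hk']; exact hbdry s hsτ j
      · exact (hM s hsτ j k).1
    -- pointwise size of the quadratic term on the compared shell n
    have hqpt : ∀ s ∈ Icc 0 t, |quadTerm ε₀ α S i n s| ≤
        2 * (∑ i₁, ∑ i₂, ∑ μ ∈ shiftSet, |α i₁ i₂ i μ|) * (1 + ε₀) ^ ((5 : ℝ) * n / 2) *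
          (3 * Ĝ n) * (3 * Ĝ n) := by
      intro s hs
      have h3 : ∀ k, n - 1 ≤ k → k ≤ n + 1 → A k ≤ 3 * Ĝ n := by
        intro k hk1 hk2
        have hk : k ≤ kb + 1 := by linarith
        simp only [hA, hk, if_true]
        exact mul_le_mul_of_nonneg_left (hĜ n hn k hk1 hk2) (by norm_num)
      have hb := abs_quadTerm_sub_quadTerm_le_of_le ε₀ hε α S (fun _ _ _ => (0 : ℝ)) i n s
        (A := A) (D := A) (Amax := 3 * Ĝ n) (Dmax := 3 * Ĝ n) (hAS s hs)
        (fun j k => by simpa using hA0 k) (fun j k => by simpa using hAS s hs j k) h3 h3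
      have hz : quadTerm ε₀ α (fun _ _ _ => (0 : ℝ)) i n s = 0 := by simp [quadTerm]
      rwa [hz, sub_zero] at hb
    -- the integral of the quadratic term
    have hsub : uIcc 0 t ⊆ Icc 0 τ := by
      rw [uIcc_of_le ht.1]; exact Icc_subset_Icc_right ht.2
    have hqint : IntervalIntegrable (fun s => quadTerm ε₀ α S i n s) volume 0 t :=
      ((pseudoFlowOn_continuousOn_quadTerm h i n).mono hsub).intervalIntegrable
    set Q : ℝ := 2 * (∑ i₁, ∑ i₂, ∑ μ ∈ shiftSet, |α i₁ i₂ i μ|) * (1 + ε₀) ^ ((5 : ℝ) * n / 2) *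
      (3 * Ĝ n) * (3 * Ĝ n) with hQ
    have hQ0 : 0 ≤ Q := (abs_nonneg _).trans (hqpt 0 ⟨le_rfl, ht.1⟩)
    have hI : |∫ s in (0 : ℝ)..t, quadTerm ε₀ α S i n s| ≤ G n / 2 := by
      calc |∫ s in (0 : ℝ)..t, quadTerm ε₀ α S i n s|
          ≤ ∫ s in (0 : ℝ)..t, |quadTerm ε₀ α S i n s| :=
            intervalIntegral.abs_integral_le_integral_abs ht.1
        _ ≤ ∫ s in (0 : ℝ)..t, Q :=
            intervalIntegral.integral_mono_on ht.1 hqint.abs (by simp) fun s hs => hqpt s hs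
        _ = t * Q := by simp
        _ ≤ τ * Q := mul_le_mul_of_nonneg_right ht.2 hQ0
        _ ≤ G n / 2 := hcond i n hn
    have hmot := pseudoFlowOn_motion_integral h hτ i n ht
    have hdefn := hdef i n hn t ht
    have htri : |S i n t - S₀ i n| ≤
        |S i n t - S₀ i n - ∫ s in (0 : ℝ)..t, quadTerm ε₀ α S i n s| +
          |∫ s in (0 : ℝ)..t, quadTerm ε₀ α S i n s| := by
      have := abs_add_le (S i n t - S₀ i n - ∫ s in (0 : ℝ)..t, quadTerm ε₀ α S i n s)
        (∫ s in (0 : ℝ)..t, quadTerm ε₀ α S i n s)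
      simpa using this
    linarith

end GappedFrontRobust

end Summit.NavierStokesRegularity.NavierStokesRegularity.Theorems

end
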